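import Literature.AlgebraicGeometry.Resolution.CentreBlowupMohStability
import Literature.AlgebraicGeometry.Resolution.PointBlowupNearRidge
import Summits.ResolutionOfSingularities.ResolutionOfSingularities.Theorems.MarkedTransferCampaignW46MohWindowShade

/-!
# [OURS · L1 W4.6] Rung (iii) "Moh window" for the classical pair, CENTRE version: inside
  `p ≤ ord₀ F < 2p` the blow-up of a Moh-permissible coordinate centre of any dimension does not
  increase the shade at an equimultiple point of the fibre over the origin

Cell `res-hironaka`, rung L, slot W4.6, seat `res-L1-s46-pv-6`; sequel of
`MarkedTransferCampaignW46MohWindowShade.lean` (point blow-ups).  The actual surface / threefold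
procedures blow up curves when the top locus is a curve, so the rung is stated here for the tree's
coordinate-centre model `CentreBlowup` (`Literature/AlgebraicGeometry/Resolution/PointBlowupShadeCentres.lean`:
`CState = (F, r, exc)`, `CentreBlowup.step p S j b s` = blow-up of `C_S = {x = 0, y_i = 0 (i ∈ S)}`,
chart `y_j` (`j ∈ S`), point `b` of the fibre over the origin, cleaning; `CState.shade`).

## What is proved (prime `p`, field `K` of characteristic `p`, finite `σ`; `s = (F, r, exc)` with `F`
## cleaned, `y^r ∣ F`, `o = ord₀ F`; `S ∋ j`; `b_j = 0`, `b_i = 0` for `i ∉ S`; `C_S` in the `p`-fold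
## locus — `degIn S d ≥ p` on the support — and Moh-permissible — `degIn S d ≥ degIn S r + shade`)

* `shade_step_le_of_lt_two_mul_centre`: `o < 2p` (hence `p ≤ o < 2p`) and
  `CentreBlowup.IsEquimultiplePoint p S j b s` ⟹ `(CentreBlowup.step p S j b s).shade ≤ s.shade`.
* `shade_antitone_along_of_window_centre`: along any sequence of such steps (centres `S n`, charts
  `j n ∈ S n`, points `b n` over the origin, every step equimultiple and Moh-permissible) that stays in
  the window, the shade is non-increasing.

## Proof
Transfer to the point case (tree `CentreBlowup.shade_step_le_shade_pointStep`: the centre-step shade is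
at most the point-step shade), then: `p ∤ o` — no increase of the point step at any point (tree
`PointBlowup.shade_step_le_of_not_dvd`); `o = p` — a point-step increase loses an exceptional component
`{y_i = 0}`, `r_i ≥ 1`, `b_i ≠ 0` (tree `PointBlowup.necessary_of_shadeIncreases` (iii)), near ⟹ ridge
for the CENTRE blow-up (tree `CentreBlowup.nearOnDirectrixAtCentre`, [CossartJannsenSaito2020,
Rem. 18.29] in the model) makes `F_p` additive along `v = e_j + Σ b_i e_i` with `v_i ≠ 0`, contradicting
`MohWindowShade.not_additiveAlong_of_dvd` (the polar read at a monomial of least `y_i`-exponent).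
OURS; replaces, for the classical pair (order, shade), the role of Th. 16.6 (2) / Eq. (127) (ms. p. 84)
in regime (iii) of RESCUE-SEED W4.6 for permissible centres of any dimension; NOT a statement of the
manuscript [claim: Hironaka2017, status: under-review], nothing of which is used.  AI review is weaker
than expert review.
-/

noncomputable section

set_option linter.dupNamespace false -- mandated namespace of this single-conjunct summit

open MvPolynomial Finset

open scoped BigOperators

namespace Summit.ResolutionOfSingularities.ResolutionOfSingularities.Theorems.CampaignW46.MohWindowShadeCentres

open Literature.AlgebraicGeometry.Resolution
open Literature.AlgebraicGeometry.Resolution.CentreBlowup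
open Literature.AlgebraicGeometry.Resolution.Hauser2010
open Literature.AlgebraicGeometry.Resolution.HauserPerlega2019 (initialForm)
open Summit.ResolutionOfSingularities.ResolutionOfSingularities.Theorems.CampaignW46.MohWindowShade

variable {σ : Type*} {K : Type*} [Field K] [Fintype σ] [DecidableEq σ] [DecidableEq K]
variable (p : ℕ) [hp : Fact p.Prime] [CharP K p]

omit [DecidableEq σ] [Fintype σ] [DecidableEq K] hp in
/-- `C_S` lies in the `p`-fold locus: `p ≤ ord_{C_S} F` from the monomialwise bound. [folklore] -/
theorem le_ordAlong_of_forall (S : Finset σ) (F : MvPolynomial σ K) {q : ℕ}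
    (hq : ∀ d ∈ F.support, q ≤ degIn S d) : (q : ℕ∞) ≤ ordAlong S F := by
  unfold ordAlong
  exact Finset.le_inf fun d hd => by exact_mod_cast hq d hd

/-- **[OURS · L1 W4.6] Rung (iii), Moh window, one blow-up of a Moh-permissible coordinate centre:**
inside `p ≤ ord₀ F < 2p`, at every equimultiple point of the fibre over the origin (every chart
`y_j`, `j ∈ S`), the shade does not increase.  Every field of characteristic `p`, every number of
variables, centres of every dimension.  NOT a statement of the manuscript. [folklore] -/
theorem shade_step_le_of_lt_two_mul_centre {S : Finset σ} {j : σ} (hj : j ∈ S) (b : σ → K)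
    (hbj : b j = 0) (hbN : ∀ i, i ∉ S → b i = 0) (s : CState σ K)
    (hclean : deletePthPowers p s.F = s.F) {o : ℕ} (ho : ordZero s.F = o) (ho2 : o < 2 * p)
    (hr : ∀ d ∈ s.F.support, s.r ≤ d) (hq : ∀ d ∈ s.F.support, p ≤ degIn S d)
    (hperm : ∀ d ∈ s.F.support, degIn S s.r + (o - s.r.degree) ≤ degIn S d)
    (heq : CentreBlowup.IsEquimultiplePoint p S j b s) :
    (CentreBlowup.step p S j b s).shade ≤ s.shade := by
  obtain ⟨hpo, -, -⟩ := le_of_forall_le_degIn S s ho hr hperm hq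
  refine le_trans (shade_step_le_shade_pointStep p hj b hbj hbN s ho hr hq hperm) ?_
  -- the point step with the same chart and point does not increase the shade
  by_contra hlt
  have hinc : PointBlowup.ShadeIncreases p j b s.toState := not_le.mp hlt
  obtain ⟨hdvd, -, i, hij, hbi, hri, -⟩ :=
    PointBlowup.necessary_of_shadeIncreases p j b hbj s.toState hclean ho hpo hr hinc
  -- inside the window `p ∣ o` forces `o = p`
  have hop : o = p := by
    obtain ⟨c, hc⟩ := hdvd
    have hc1 : c = 1 := by
      rcases Nat.lt_or_ge c 1 with h | h
      · rw [show c = 0 by omega, mul_zero] at hc; omega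
      · by_contra h2
        have : p * 2 ≤ p * c := Nat.mul_le_mul_left p (by omega); omega
    rw [hc, hc1, mul_one]
  rw [hop] at ho
  -- near ⟹ ridge for the centre blow-up: `F_p` is additive along `direction j b`
  have hadd : PointBlowup.AdditiveAlong (initialForm s.F) (PointBlowup.direction j b) :=
    nearOnDirectrixAtCentre p S j hj b hbj hbN s ho (le_ordAlong_of_forall S s.F hq) heq
  -- the lost component `{y_i = 0}` (`r_i ≥ 1`, `b_i ≠ 0`) contradicts the polar lemma
  have hri1 : 1 ≤ s.r i := Nat.one_le_iff_ne_zero.mpr hri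
  exact not_additiveAlong_of_dvd p s.toState hclean ho (k := i)
    (fun d hd => le_trans hri1 (hr d hd i))
    (by rw [PointBlowup.direction, Function.update_of_ne hij]; exact hbi) hadd

/-- **[OURS · L1 W4.6] The same with the window as `ℕ∞` hypotheses** (`ord₀ F < 2p`; `p ≤ ord₀ F` is
implied by the `p`-fold-locus hypothesis). NOT a statement of the manuscript. [folklore] -/
theorem shade_step_le_of_window_centre {S : Finset σ} {j : σ} (hj : j ∈ S) (b : σ → K)
    (hbj : b j = 0) (hbN : ∀ i, i ∉ S → b i = 0) (s : CState σ K)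
    (hclean : deletePthPowers p s.F = s.F) (hhi : ordZero s.F < (2 * p : ℕ))
    (hr : ∀ d ∈ s.F.support, s.r ≤ d) (hq : ∀ d ∈ s.F.support, p ≤ degIn S d)
    (hperm : ∀ d ∈ s.F.support, ((degIn S s.r : ℕ) : ℕ∞) + s.shade ≤ (degIn S d : ℕ))
    (heq : CentreBlowup.IsEquimultiplePoint p S j b s) :
    (CentreBlowup.step p S j b s).shade ≤ s.shade := by
  have hne : ordZero s.F ≠ ⊤ := ne_top_of_lt hhi
  obtain ⟨o, ho'⟩ := WithTop.ne_top_iff_exists.mp hne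
  have ho : ordZero s.F = o := ho'.symm
  have ho2 : o < 2 * p := by rw [ho] at hhi; exact_mod_cast hhi
  have hpermN : ∀ d ∈ s.F.support, degIn S s.r + (o - s.r.degree) ≤ degIn S d := by
    intro d hd
    have h := hperm d hd
    rw [CState.shade_eq_of_ordZero_eq s ho] at h
    exact_mod_cast h
  exact shade_step_le_of_lt_two_mul_centre p hj b hbj hbN s hclean ho ho2 hr hq hpermN heq

/-- **[OURS · L1 W4.6] Rung (iii) along a sequence of Moh-permissible coordinate-centre blow-ups.**
Centres `C_{S n}` of any dimension, charts `j n ∈ S n`, points `b n` of the fibre over the origin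
(`b n (j n) = 0`, `b n i = 0` off `S n`), each centre in the `p`-fold locus and Moh-permissible, each
point equimultiple, from a cleaned state with `y^r ∣ F`; if `ord₀ F_n < 2p` for all `n < N` then
`shade(s_m) ≤ shade(s_n)` for `n ≤ m ≤ N`.  NOT a statement of the manuscript. [folklore] -/
theorem shade_antitone_along_of_window_centre (s : ℕ → CState σ K) (S : ℕ → Finset σ)
    (j : ℕ → σ) (b : ℕ → σ → K) (hj : ∀ n, j n ∈ S n) (hb : ∀ n, b n (j n) = 0)
    (hbN : ∀ n i, i ∉ S n → b n i = 0)
    (hstep : ∀ n, s (n + 1) = CentreBlowup.step p (S n) (j n) (b n) (s n))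
    (hclean : deletePthPowers p (s 0).F = (s 0).F) (hr : ∀ d ∈ (s 0).F.support, (s 0).r ≤ d)
    (hq : ∀ n, ∀ d ∈ (s n).F.support, p ≤ degIn (S n) d)
    (hperm : ∀ n, ∀ d ∈ (s n).F.support,
      ((degIn (S n) (s n).r : ℕ) : ℕ∞) + (s n).shade ≤ (degIn (S n) d : ℕ))
    (heq : ∀ n, CentreBlowup.IsEquimultiplePoint p (S n) (j n) (b n) (s n))
    {N : ℕ} (hwin : ∀ n, n < N → ordZero (s n).F < (2 * p : ℕ)) {n m : ℕ} (hnm : n ≤ m)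
    (hmN : m ≤ N) : (s m).shade ≤ (s n).shade := by
  -- invariants: cleaned and `y^r ∣ F`
  have hinv : ∀ n, deletePthPowers p (s n).F = (s n).F ∧ ∀ d ∈ (s n).F.support, (s n).r ≤ d := by
    intro n
    induction n with
    | zero => exact ⟨hclean, hr⟩
    | succ n ih =>
      obtain ⟨ih1, ih2⟩ := ih
      rw [hstep n]
      refine ⟨deletePthPowers_step p (S n) (j n) (b n) (s n), ?_⟩
      by_cases htop : ordZero (s n).F = ⊤
      · -- `F_n = 0`: the step of the zero polynomial is zero
        have hF0 : (s n).F = 0 := by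
          unfold ordZero at htop
          rwa [MvPowerSeries.order_eq_top_iff, MvPolynomial.coe_eq_zero_iff] at htop
        intro d hd
        exfalso
        have : (CentreBlowup.step p (S n) (j n) (b n) (s n)).F = 0 := by
          show deletePthPowers p (CentreBlowup.pointTransform p (S n) (j n) (b n) (s n)) = 0
          unfold CentreBlowup.pointTransform CentreBlowup.chartTransform PointBlowup.translate
          rw [hF0]
          simp [deletePthPowers]
        rw [this, MvPolynomial.support_zero] at hd
        exact absurd hd (Finset.notMem_empty d)
      · obtain ⟨o, ho'⟩ := WithTop.ne_top_iff_exists.mp htop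
        have ho : ordZero (s n).F = o := ho'.symm
        have hpermN : ∀ d ∈ (s n).F.support,
            degIn (S n) (s n).r + (o - (s n).r.degree) ≤ degIn (S n) d := by
          intro d hd
          have h := hperm n d hd
          rw [CState.shade_eq_of_ordZero_eq (s n) ho] at h
          exact_mod_cast h
        exact newMult_le_of_mem_support_step p (S n) (j n) (b n) (hb n) (s n) ho ih2 hpermN
  have hone : ∀ n, n < N → (s (n + 1)).shade ≤ (s n).shade := by
    intro n hn
    obtain ⟨h1, h2⟩ := hinv n
    rw [hstep n]
    exact shade_step_le_of_window_centre p (hj n) (b n) (hb n) (hbN n) (s n) h1 (hwin n hn) h2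
      (hq n) (hperm n) (heq n)
  obtain ⟨k, rfl⟩ := Nat.exists_eq_add_of_le hnm
  clear hnm
  induction k with
  | zero => exact le_rfl
  | succ k ih =>
    have hk : n + k < N := by omega
    have := hone (n + k) hk
    rw [show n + (k + 1) = n + k + 1 by omega]
    exact le_trans this (ih (by omega))

end Summit.ResolutionOfSingularities.ResolutionOfSingularities.Theorems.CampaignW46.MohWindowShadeCentres
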